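import Summits.NavierStokesRegularity.FunctionalMining.StretchingLaminateHolder
import Mathlib.Tactic.LinearCombination
import Mathlib.Tactic.Linarith
import HarnessLib

/-!
# FunctionalMining — K1-Q1 laminates: the Λ-AFFINE side of THEOREM L-CAP — isometry (I1) and the LAMINATE BETCHOV IDENTITY (I2) in the kernel (dict seat, staged)

search for candidate a priori estimates; no regularity claim.  Static, finite, RATIONAL tree algebra about the
div-free lamination trees of `StretchingLaminates` (aa) / `StretchingLaminateCalculus` (ac) /
`StretchingLaminateHolder` (ad); nothing here is about Navier–Stokes solutions, and nothing is a literature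
claim.  Everything is [ours; elementary].

Source (paper level, ours): bank g5, `pub-nsfunc-bank/K1Q1-LAMINATE-CAP.md` §1 (THEOREM L-CAP, 2026-08-20):
a rank-one div-free increment `B = c nᵀ` with `c·n = 0` is NILPOTENT, `B² = (c·n) B = 0`, hence every
polynomial `Ψ` with `t ↦ Ψ(G + tB)` affine ("Λ-affine") is a martingale down a valid tree:
`Σ_L W_L Ψ(G_L) = W·Ψ(G)`.  This file types the generic weighted leaf sum and proves the principle, then
instantiates it twice:

* `Tree.leafSum f G W 𝒯 = Σ_L W_L f(G_L)` (generic weighted leaf functional; `stretchFrom`/`energyFrom` of (aa)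
  are `leafSum stretch` / `leafSum halfGradSq`), `leafSum_one` (the weights sum to `W`), and the MARTINGALE
  PRINCIPLE `Tree.leafSum_eq_of_split`: an exact split identity
  `λ f(G₊) + (1−λ) f(G₋) = f(G) + (c·n)·P(G,s)` makes `leafSum f G W 𝒯 = W f(G)` on valid trees.
* **(I1) isometry.** `Grad.trSq = tr G²`, `trSq_eq : tr G² = |S|² − ½|ω|²`, split identity
  `trSq_split` (remainder `λ(1−λ)(c·n)²`), hence `leafSum_sSq_sub_half_vortSq` and at the root
  `Tree.energy_eq_leafSum_sSq : E(𝒯) = Σ_L W_L |S_L|²` and `Tree.energy_eq_half_leafSum_vortSq :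
  E(𝒯) = ½ Σ_L W_L |ω_L|²`.
* **(I2) laminate Betchov.** `Grad.cubeTrace = tr G³`, `Grad.symCubeTrace = tr S³` (`S = (G+Gᵀ)/2`), the
  pointwise identity `cubeTrace_eq : tr G³ = tr S³ + ¾ ωᵀSω − ¾ |ω|² tr G`, the split identity
  `cubeTrace_split` (remainder `(c·n)·cubeSplitRem`), hence `leafSum_cubeTrace` and, along trace-free
  states, `leafSum_symCube_add_stretch`; at the root **`Tree.betchov :
  Σ_L W_L tr S_L³ + ¾ σ(𝒯) = 0`**, i.e. `σ(𝒯) = −(4/3) Σ_L W_L tr S_L³` — the exact tree analogue of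
  Betchov's `⟨ω·Sω⟩ = −(4/3)⟨tr S³⟩`.
* Unit checks on `board` and `treeD4` of (aa) by `decide +kernel`.

The companion file `StretchingLaminateQuartic` (ao) adds the quartic supersolution (T4) and the dual
assembly `LeafClaim θ a b c → RatioBound θ` of THEOREM L-CAP.  search for candidate a priori estimates; no regularity claim.
-/


namespace Summit.NavierStokesRegularity.FunctionalMining

namespace Laminate

namespace Grad

/-- `tr G²`. [ours; bookkeeping] -/
def trSq (G : Grad) : ℚ := G.g00^2 + 2*G.g01*G.g10 + 2*G.g02*G.g20 + G.g11^2 + 2*G.g12*G.g21 + G.g22^2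

/-- `tr G³`. [ours; bookkeeping] -/
def cubeTrace (G : Grad) : ℚ :=
  G.g00^3 + 3*G.g00*G.g01*G.g10 + 3*G.g00*G.g02*G.g20 + 3*G.g01*G.g10*G.g11 + 3*G.g01*G.g12*G.g20
      + 3*G.g02*G.g10*G.g21 + 3*G.g02*G.g20*G.g22 + G.g11^3 + 3*G.g11*G.g12*G.g21
      + 3*G.g12*G.g21*G.g22 + G.g22^3

/-- `tr S³` for `S = (G + Gᵀ)/2` (expanded). [ours; bookkeeping] -/
def symCubeTrace (G : Grad) : ℚ :=
  G.g00^3 + 3*G.g00*G.g01^2/4 + 3*G.g00*G.g01*G.g10/2 + 3*G.g00*G.g02^2/4 + 3*G.g00*G.g02*G.g20/2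
      + 3*G.g00*G.g10^2/4 + 3*G.g00*G.g20^2/4 + 3*G.g01^2*G.g11/4 + 3*G.g01*G.g02*G.g12/4
      + 3*G.g01*G.g02*G.g21/4 + 3*G.g01*G.g10*G.g11/2 + 3*G.g01*G.g12*G.g20/4 + 3*G.g01*G.g20*G.g21/4
      + 3*G.g02^2*G.g22/4 + 3*G.g02*G.g10*G.g12/4 + 3*G.g02*G.g10*G.g21/4 + 3*G.g02*G.g20*G.g22/2
      + 3*G.g10^2*G.g11/4 + 3*G.g10*G.g12*G.g20/4 + 3*G.g10*G.g20*G.g21/4 + G.g11^3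
      + 3*G.g11*G.g12^2/4 + 3*G.g11*G.g12*G.g21/2 + 3*G.g11*G.g21^2/4 + 3*G.g12^2*G.g22/4
      + 3*G.g12*G.g21*G.g22/2 + 3*G.g20^2*G.g22/4 + 3*G.g21^2*G.g22/4 + G.g22^3

/-- The remainder polynomial of the cubic split identity (it multiplies `c·n`, so it is invisible on div-free
splits). [ours; bookkeeping] -/
def cubeSplitRem (G : Grad) (s : Split) : ℚ :=
  -3*G.g00*s.c0*s.lam^2*s.n0 + 3*G.g00*s.c0*s.lam*s.n0 - 3*G.g01*s.c1*s.lam^2*s.n0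
      + 3*G.g01*s.c1*s.lam*s.n0 - 3*G.g02*s.c2*s.lam^2*s.n0 + 3*G.g02*s.c2*s.lam*s.n0
      - 3*G.g10*s.c0*s.lam^2*s.n1 + 3*G.g10*s.c0*s.lam*s.n1 - 3*G.g11*s.c1*s.lam^2*s.n1
      + 3*G.g11*s.c1*s.lam*s.n1 - 3*G.g12*s.c2*s.lam^2*s.n1 + 3*G.g12*s.c2*s.lam*s.n1
      - 3*G.g20*s.c0*s.lam^2*s.n2 + 3*G.g20*s.c0*s.lam*s.n2 - 3*G.g21*s.c1*s.lam^2*s.n2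
      + 3*G.g21*s.c1*s.lam*s.n2 - 3*G.g22*s.c2*s.lam^2*s.n2 + 3*G.g22*s.c2*s.lam*s.n2
      + 2*s.c0^2*s.lam^3*s.n0^2 - 3*s.c0^2*s.lam^2*s.n0^2 + s.c0^2*s.lam*s.n0^2
      + 4*s.c0*s.c1*s.lam^3*s.n0*s.n1 - 6*s.c0*s.c1*s.lam^2*s.n0*s.n1 + 2*s.c0*s.c1*s.lam*s.n0*s.n1
      + 4*s.c0*s.c2*s.lam^3*s.n0*s.n2 - 6*s.c0*s.c2*s.lam^2*s.n0*s.n2 + 2*s.c0*s.c2*s.lam*s.n0*s.n2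
      + 2*s.c1^2*s.lam^3*s.n1^2 - 3*s.c1^2*s.lam^2*s.n1^2 + s.c1^2*s.lam*s.n1^2
      + 4*s.c1*s.c2*s.lam^3*s.n1*s.n2 - 6*s.c1*s.c2*s.lam^2*s.n1*s.n2 + 2*s.c1*s.c2*s.lam*s.n1*s.n2
      + 2*s.c2^2*s.lam^3*s.n2^2 - 3*s.c2^2*s.lam^2*s.n2^2 + s.c2^2*s.lam*s.n2^2

/-- `tr 0² = 0`. [ours; bookkeeping] -/
theorem trSq_zero : Grad.zero.trSq = 0 := by simp [zero, trSq]

/-- `tr 0³ = 0`. [ours; bookkeeping] -/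
theorem cubeTrace_zero : Grad.zero.cubeTrace = 0 := by simp [zero, cubeTrace]

/-- **`tr G² = |S|² − ½|ω|²`** (symmetric/antisymmetric split). [ours; elementary] -/
theorem trSq_eq (G : Grad) : G.trSq = G.sSq - G.vortSq / 2 := by
  simp only [trSq, sSq, vortSq, vort0, vort1, vort2]; ring

/-- **`tr G³ = tr S³ + ¾ ωᵀSω − ¾ |ω|² tr G`** (with `A = (G − Gᵀ)/2`, `A² = ¼(ωωᵀ − |ω|²I)`, odd-in-`A` traces
vanish). [ours; elementary] -/
theorem cubeTrace_eq (G : Grad) :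
    G.cubeTrace = G.symCubeTrace + 3 / 4 * G.stretch - 3 / 4 * G.vortSq * G.trace := by
  simp only [cubeTrace, symCubeTrace, stretch, vortSq, vort0, vort1, vort2, trace]; ring

/-- At a trace-free state: `tr S³ + ¾ ωᵀSω = tr G³`. [ours; elementary] -/
theorem symCube_add_stretch_eq (G : Grad) (h : G.trace = 0) :
    G.symCubeTrace + 3 / 4 * G.stretch = G.cubeTrace := by
  rw [cubeTrace_eq, h]; ring

/-- **Split identity for `tr G²`**: `λ tr(G₊²) + (1−λ) tr(G₋²) = tr G² + λ(1−λ)(c·n)²` (`tr B² = (c·n)²`).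
[ours; elementary] -/
theorem trSq_split (G : Grad) (s : Split) :
    s.lam * (G.layer (1 - s.lam) s).trSq + (1 - s.lam) * (G.layer (-s.lam) s).trSq
      = G.trSq + s.dot * (s.lam * (1 - s.lam) * s.dot) := by
  simp only [trSq, layer, Split.dot]; ring

/-- **Split identity for `tr G³`** (nilpotency `B² = (c·n)B`): `λ tr(G₊³) + (1−λ) tr(G₋³) = tr G³ + (c·n)·R`.
[ours; elementary] -/
theorem cubeTrace_split (G : Grad) (s : Split) :
    s.lam * (G.layer (1 - s.lam) s).cubeTrace + (1 - s.lam) * (G.layer (-s.lam) s).cubeTrace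
      = G.cubeTrace + s.dot * G.cubeSplitRem s := by
  simp only [cubeTrace, cubeSplitRem, layer, Split.dot]; ring

end Grad

namespace Tree

/-- **Generic weighted leaf functional** `Σ_L W_L f(G_L)` of the subtree below a node in state `G` with
weight `W`. [ours; bookkeeping] -/
def leafSum (f : Grad → ℚ) (G : Grad) (W : ℚ) : Tree → ℚ
  | leaf => W * f G
  | node s p m => leafSum f (G.layer (1 - s.lam) s) (W * s.lam) p
      + leafSum f (G.layer (-s.lam) s) (W * (1 - s.lam)) m

/-- `stretchFrom = leafSum stretch`. [ours; bookkeeping] -/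
theorem stretchFrom_eq_leafSum (T : Tree) : ∀ (G : Grad) (W : ℚ), T.stretchFrom G W = T.leafSum Grad.stretch G W := by
  induction T with
  | leaf => intro G W; simp [stretchFrom, leafSum]
  | node s p m ihp ihm => intro G W; simp only [stretchFrom, leafSum, ihp, ihm]

/-- `energyFrom = leafSum halfGradSq`. [ours; bookkeeping] -/
theorem energyFrom_eq_leafSum (T : Tree) : ∀ (G : Grad) (W : ℚ), T.energyFrom G W = T.leafSum Grad.halfGradSq G W := by
  induction T with
  | leaf => intro G W; simp [energyFrom, leafSum]
  | node s p m ihp ihm => intro G W; simp only [energyFrom, leafSum, ihp, ihm]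

/-- **The weights sum to `W`**: `Σ_L W_L = W`. [ours; bookkeeping] -/
theorem leafSum_one (T : Tree) : ∀ (G : Grad) (W : ℚ), T.leafSum (fun _ => 1) G W = W := by
  induction T with
  | leaf => intro G W; simp [leafSum]
  | node s p m ihp ihm => intro G W; simp only [leafSum, ihp, ihm]; ring

/-- **Martingale principle.** If `f` satisfies an exact split identity whose remainder is a multiple of `c·n`,
then `Σ_L W_L f(G_L) = W f(G)` on every VALID tree (div-free splits). [ours; elementary] -/
theorem leafSum_eq_of_split (f : Grad → ℚ) (P : Grad → Split → ℚ)
    (hf : ∀ (G : Grad) (s : Split),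
      s.lam * f (G.layer (1 - s.lam) s) + (1 - s.lam) * f (G.layer (-s.lam) s) = f G + s.dot * P G s)
    (T : Tree) (hT : T.valid = true) : ∀ (G : Grad) (W : ℚ), T.leafSum f G W = W * f G := by
  induction T with
  | leaf => intro G W; simp [leafSum]
  | node s p m ihp ihm =>
      intro G W
      obtain ⟨-, -, hdot, hp, hm⟩ := valid_node hT
      simp only [leafSum, ihp hp, ihm hm]
      have h := hf G s
      rw [hdot, zero_mul, add_zero] at h
      linear_combination W * h

/-- **(I1) as a martingale**: `Σ_L W_L tr G_L² = W tr G²`. [ours; elementary] -/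
theorem leafSum_trSq (T : Tree) (hT : T.valid = true) :
    ∀ (G : Grad) (W : ℚ), T.leafSum Grad.trSq G W = W * G.trSq :=
  leafSum_eq_of_split Grad.trSq (fun _ s => s.lam * (1 - s.lam) * s.dot) Grad.trSq_split T hT

/-- **(I2) as a martingale**: `Σ_L W_L tr G_L³ = W tr G³`. [ours; elementary] -/
theorem leafSum_cubeTrace (T : Tree) (hT : T.valid = true) :
    ∀ (G : Grad) (W : ℚ), T.leafSum Grad.cubeTrace G W = W * G.cubeTrace :=
  leafSum_eq_of_split Grad.cubeTrace Grad.cubeSplitRem Grad.cubeTrace_split T hT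

/-- (I1) unfolded: `Σ_L W_L |S_L|² − ½ Σ_L W_L |ω_L|² = W·tr G²`. [ours; elementary] -/
theorem leafSum_sSq_sub_half_vortSq (T : Tree) (hT : T.valid = true) (G : Grad) (W : ℚ) :
    T.leafSum Grad.sSq G W - T.leafSum Grad.vortSq G W / 2 = W * G.trSq := by
  have key : ∀ (T : Tree) (G : Grad) (W : ℚ),
      T.leafSum Grad.sSq G W - T.leafSum Grad.vortSq G W / 2 = T.leafSum Grad.trSq G W := by
    intro T
    induction T with
    | leaf => intro G W; simp only [leafSum, Grad.trSq_eq]; ring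
    | node s p m ihp ihm =>
        intro G W
        simp only [leafSum]
        linear_combination ihp (G.layer (1 - s.lam) s) (W * s.lam) + ihm (G.layer (-s.lam) s) (W * (1 - s.lam))
  rw [key, leafSum_trSq T hT]

/-- `energyFrom = ½ Σ W|S_L|² + ¼ Σ W|ω_L|²` (pointwise `½|G|² = ½|S|² + ¼|ω|²`). [ours; elementary] -/
theorem energyFrom_eq_leafSums (T : Tree) (G : Grad) (W : ℚ) :
    T.energyFrom G W = T.leafSum Grad.sSq G W / 2 + T.leafSum Grad.vortSq G W / 4 := by
  have key : ∀ (T : Tree) (G : Grad) (W : ℚ),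
      T.energyFrom G W = T.leafSum Grad.sSq G W / 2 + T.leafSum Grad.vortSq G W / 4 := by
    intro T
    induction T with
    | leaf =>
        intro G W; simp only [energyFrom, leafSum]
        have h := Grad.two_halfGradSq_eq G
        linear_combination W / 2 * h
    | node s p m ihp ihm =>
        intro G W
        simp only [energyFrom, leafSum, ihp, ihm]; ring
  exact key T G W

/-- **(I1) ISOMETRY at the root**: `E(𝒯) = Σ_L W_L |S_L|²` for every valid tree. [ours; elementary] -/
theorem energy_eq_leafSum_sSq (T : Tree) (hT : T.valid = true) : T.energy = T.leafSum Grad.sSq Grad.zero 1 := by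
  have h1 := energyFrom_eq_leafSums T Grad.zero 1
  have h2 := leafSum_sSq_sub_half_vortSq T hT Grad.zero 1
  rw [Grad.trSq_zero, mul_zero] at h2
  rw [energy, h1]; linarith

/-- **(I1), vorticity form**: `E(𝒯) = ½ Σ_L W_L |ω_L|²`. [ours; elementary] -/
theorem energy_eq_half_leafSum_vortSq (T : Tree) (hT : T.valid = true) :
    T.energy = T.leafSum Grad.vortSq Grad.zero 1 / 2 := by
  have h1 := energyFrom_eq_leafSums T Grad.zero 1
  have h2 := leafSum_sSq_sub_half_vortSq T hT Grad.zero 1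
  rw [Grad.trSq_zero, mul_zero] at h2
  rw [energy, h1]; linarith

/-- **(I2) along trace-free states**: `Σ_L W_L tr S_L³ + ¾ Σ_L W_L ω_LᵀS_Lω_L = W tr G³` below any trace-free
`G` on a valid tree (div-free splits keep every state trace-free). [ours; elementary] -/
theorem leafSum_symCube_add_stretch (T : Tree) (hT : T.valid = true) :
    ∀ (G : Grad) (W : ℚ), G.trace = 0 →
      T.leafSum Grad.symCubeTrace G W + 3 / 4 * T.leafSum Grad.stretch G W = W * G.cubeTrace := by
  induction T with
  | leaf =>
      intro G W htr; simp only [leafSum]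
      have h := Grad.symCube_add_stretch_eq G htr
      linear_combination W * h
  | node s p m ihp ihm =>
      intro G W htr
      obtain ⟨-, -, hdot, hp, hm⟩ := valid_node hT
      have htrP : (G.layer (1 - s.lam) s).trace = 0 := by rw [Grad.trace_layer, htr, hdot]; ring
      have htrM : (G.layer (-s.lam) s).trace = 0 := by rw [Grad.trace_layer, htr, hdot]; ring
      have hP := ihp hp _ (W * s.lam) htrP
      have hM := ihm hm _ (W * (1 - s.lam)) htrM
      have h := Grad.cubeTrace_split G s
      rw [hdot, zero_mul, add_zero] at h
      simp only [leafSum]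
      linear_combination hP + hM + W * h

/-- **THE LAMINATE BETCHOV IDENTITY (I2)**: `Σ_L W_L tr S_L³ + ¾ σ(𝒯) = 0` for every valid (div-free)
lamination tree rooted at `0`, i.e. `σ(𝒯) = −(4/3) Σ_L W_L tr S_L³` — the exact tree analogue of Betchov's
`⟨ω·Sω⟩ = −(4/3)⟨tr S³⟩` (THEOREM L-CAP §1). [ours; elementary] -/
theorem betchov (T : Tree) (hT : T.valid = true) :
    T.leafSum Grad.symCubeTrace Grad.zero 1 + 3 / 4 * T.sigma = 0 := by
  have h := leafSum_symCube_add_stretch T hT Grad.zero 1 Grad.trace_zero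
  rw [Grad.cubeTrace_zero, mul_zero, ← stretchFrom_eq_leafSum] at h
  simpa [sigma] using h

/-- Betchov, solved for `σ`: `σ(𝒯) = −(4/3) Σ_L W_L tr S_L³`. [ours; elementary] -/
theorem sigma_eq_neg_four_thirds_symCube (T : Tree) (hT : T.valid = true) :
    T.sigma = -(4 / 3) * T.leafSum Grad.symCubeTrace Grad.zero 1 := by
  have h := betchov T hT; linarith

/-! ## Unit checks (`decide +kernel`) on the trees of (aa) -/

/-- `board`: `Σ W tr S_L³ = −3/16 = −¾·σ(board)` (`σ(board) = 1/4`). [ours; bookkeeping] -/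
theorem board_symCube : board.leafSum Grad.symCubeTrace Grad.zero 1 = -3 / 16 := by decide +kernel

/-- `board`: isometry `E = Σ W|S_L|² = 1/2`. [ours; bookkeeping] -/
theorem board_leafSum_sSq : board.leafSum Grad.sSq Grad.zero 1 = 1 / 2 := by decide +kernel

/-- `treeD4`: Betchov holds exactly. [ours; bookkeeping] -/
theorem treeD4_betchov : treeD4.leafSum Grad.symCubeTrace Grad.zero 1 + 3 / 4 * treeD4.sigma = 0 := by
  decide +kernel

/-- `treeD4`: isometry holds exactly. [ours; bookkeeping] -/
theorem treeD4_isometry : treeD4.energy = treeD4.leafSum Grad.sSq Grad.zero 1 := by decide +kernel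

end Tree

end Laminate

end Summit.NavierStokesRegularity.FunctionalMining
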